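import Summits.QuantumFields.BalabanUV.Beta.BorderWardSiteLaw
import Summits.QuantumFields.BalabanUV.Beta.RootedBorderTableLaw

/-!
# `BalabanUV.Beta.RowD1SymmetriesDischarged` — binder row D1: **THE TWO SYMMETRY BINDERS hW (Ward transversality) AND hR (axis-reflection
# covariance) OF THE ROUTE THEOREM ARE DISCHARGED FOR THE LITERAL OF RECORD `JsRowD1Pin hLc N`; THE ROW END NOW RESTS ON `D1Tel` ∧ `D1Rep` ONLY**
# (β sub-cell, BINDER-OWNERS row D1 OWNER, lineage an2 gen 21)

HONEST FRAMING (cell charter, verbatim): «discharging BetaPertH makes Balaban's UV stability UNCONDITIONAL — a real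
constructive-QFT result; it is NOT the continuum limit and NOT the Clay problem.»
HONEST DEPENDENCY: continuum YM on T⁴ ⇐ BetaPertH ∧ nine spine estimates (0/9 proved); BetaPertH ⇐ (D1) ∧ (D4) ∧ CAP+tail;
G-an2-4 gates asym, D1 and NE2/3/4.
DERIVED cell leaf ([folklore] composition BY NAME, no new mathematics): G4-B `BorderWardSiteLaw.symmetries_JsRowD1Pin_of_borderBondLaw` ∕
`d1Drift_JsRowD1Pin_of_borderBondLaw_D1Tel_D1Rep` (hWb, hWM discharged by the owner's GAUGE-LETTERS chain G1 → G2 → G3∕G3b → G4-M∕G4-B; hMb by an3's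
33M4) with their LAST bond-level hypothesis `hBb` supplied by an3-g33's 33K2 `RootedBorderTableLaw.bondLaw hLc` (landed 2026-08-20, courier
leaf-05-g8).  No statement of Bałaban's papers, no `[cite:]`, no `def`, no `Prop` fact.  NOT D1, NOT `BetaPertH`, NOT continuum, NOT Clay.

WHAT:
* **`symmetries_JsRowD1Pin (hLc : Odd Lc) (hN : 2 ≤ N)`**: `(∀ j, WardTransversal (flipK (TbalOf Lc (JsRowD1Pin hLc N) j))) ∧ (∀ j,
  AxisReflectionCovariant (flipK (TbalOf Lc (JsRowD1Pin hLc N) j)))` — hypotheses `Odd Lc`, `2 ≤ N`, `[NeZero Lc]` ONLY: the binders `hW` and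
  `hR` of `OneStepKernelFamily.d1Drift_of_D1Tel_D1Rep` for the literal of record are THEOREMS (hR also as an3's
  `RootedBorderTableLaw.axisReflectionCovariant_flipK_TbalOf_JsRowD1Pin`; hW is new here).
* `wardTransversal_flipK_TbalOf_JsRowD1Pin` — the hW half alone.
* **`d1Drift_JsRowD1Pin_of_D1Tel_D1Rep`**: `D1Drift Lc (JsRowD1Pin hLc N) Nc μ ν` ⟸ `D1Tel Lc (JsRowD1Pin hLc N) Jc` ∧ `D1Rep Lc Jc Nc μ ν a SL k`
  (+ the route theorem's printed B5 facts `Prop12Printed`∕`Kernel126_127Printed`, the window data, `μ ≠ ν`, `Nc ≠ 0`, `2 ≤ Lc`, `2 ≤ N`) —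
  **BINDERS 2∕4**: the symmetry half of row D1 is closed; what remains is the telescoping identity `D1Tel` (Jc: BF-x's `JcPin` is typed,
  `D1Tel` for it is NOT proved) and the representation bound `D1Rep` (EXIT-A ⇐ G-an2-4).  CONDITIONAL on exactly those; `Nc` not pinned to `N` ((P6)).
HONEST: 2∕4 binders (hW, hR) discharged for `JsRowD1Pin`; NOT D1 (D1Tel, D1Rep open), NOT BetaPertH, NOT continuum, NOT Clay.
Provenance: β sub-cell, unit beta-an2 gen 21, 2026-08-20 (v1); no existing file touched.
-/

open Finset
open scoped BigOperators
open Literature.MathematicalPhysics.QuantumFieldTheory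
open Literature.MathematicalPhysics.QuantumFieldTheory.Balaban1983to89
open Literature.MathematicalPhysics.QuantumFieldTheory.Balaban1983to89.Beta
open PolarizationSign (WardTransversal AxisReflectionCovariant)
open OneStepResolventKernel (JetData)
open OneStepKernelFamily (TbalOf flipK D1Tel D1Rep D1Drift)
open Literature.MathematicalPhysics.QuantumFieldTheory.Balaban1983to89.Beta.VectorTailsLoc (fam kfam)
open Literature.MathematicalPhysics.QuantumFieldTheory.Balaban1983to89.Beta.VectorLegVolumeAdapter (MvE)
open BalabanStepJetsSucc (wVH)
open Summit.QuantumFields.BalabanUV.Beta.BorderedHessian (stepScale)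
open Summit.QuantumFields.BalabanUV.Beta.RowD1JointEnd (JsRowD1Pin)
open Summit.QuantumFields.BalabanUV.Beta.BorderWardSiteLaw (symmetries_JsRowD1Pin_of_borderBondLaw d1Drift_JsRowD1Pin_of_borderBondLaw_D1Tel_D1Rep)
open Summit.QuantumFields.BalabanUV.Beta.RootedBorderTableLaw (bondLaw)

namespace Summit.QuantumFields.BalabanUV.Beta.RowD1SymmetriesDischarged

variable {Lc : ℕ} [NeZero Lc]

/-- [folklore] **hW ∧ hR FOR THE LITERAL OF RECORD `JsRowD1Pin hLc N` — DISCHARGED** (`Odd Lc`, `2 ≤ N` only): G4-B's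
`symmetries_JsRowD1Pin_of_borderBondLaw` at the displayed weight `γ` with `hBb := RootedBorderTableLaw.bondLaw hLc`. -/
theorem symmetries_JsRowD1Pin (hLc : Odd Lc) {N : ℕ} (hN : 2 ≤ N) :
    (∀ j : ℕ, WardTransversal (flipK (TbalOf Lc (JsRowD1Pin hLc N) j)))
      ∧ (∀ j : ℕ, AxisReflectionCovariant (flipK (TbalOf Lc (JsRowD1Pin hLc N) j))) :=
  symmetries_JsRowD1Pin_of_borderBondLaw hLc hN (fun j => -((Lc : ℝ) ^ 8 / 2) * wVH 3 Lc j / (stepScale 3 Lc j * (Lc : ℝ) ^ 4))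
    (fun _ => rfl) (bondLaw hLc)

/-- [folklore] **THE WARD-TRANSVERSALITY BINDER hW FOR `JsRowD1Pin hLc N` — DISCHARGED.** -/
theorem wardTransversal_flipK_TbalOf_JsRowD1Pin (hLc : Odd Lc) {N : ℕ} (hN : 2 ≤ N) :
    ∀ j : ℕ, WardTransversal (flipK (TbalOf Lc (JsRowD1Pin hLc N) j)) :=
  (symmetries_JsRowD1Pin hLc hN).1

/-- [folklore] **BINDER ROW D1 FOR `JsRowD1Pin hLc N` WITH BOTH SYMMETRY BINDERS DISCHARGED**: `D1Drift Lc (JsRowD1Pin hLc N) Nc μ ν` ⟸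
`D1Tel Lc (JsRowD1Pin hLc N) Jc` ∧ `D1Rep Lc Jc Nc μ ν a SL k` (+ the route theorem's printed B5 facts, window data, `μ ≠ ν`, `Nc ≠ 0`, `2 ≤ Lc`,
`2 ≤ N`) — G4-B's `d1Drift_JsRowD1Pin_of_borderBondLaw_D1Tel_D1Rep` with `hBb := RootedBorderTableLaw.bondLaw hLc`.  CONDITIONAL on D1Tel and D1Rep
exactly; `Nc` free ((P6)). -/
theorem d1Drift_JsRowD1Pin_of_D1Tel_D1Rep (hLc : Odd Lc) (hL2 : 2 ≤ Lc) {N : ℕ} (hN : 2 ≤ N)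
    (a : ℝ) (ha : 0 < a)
    (h12 : B5.Prop12Printed (fam (fun i : ℕ+ × ℕ => ((i.1 : ℕ+) : ℕ)) (fun i => i.1.pos) MvE a ha))
    (h126 : B5.Kernel126_127Printed (kfam (fun i : ℕ+ × ℕ => ((i.1 : ℕ+) : ℕ)) MvE))
    {L : Type*} {SL : Finset L} (hSL : SL.Nonempty) (k : L → Fin 4) {μ ν : Fin 4} (hμν : μ ≠ ν) {Nc : ℝ} (hNc : Nc ≠ 0)
    (Jc : ∀ m : ℕ, JetData 3 (Lc ^ m)) (htel : D1Tel Lc (JsRowD1Pin hLc N) Jc)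
    {cc : ℝ} {M : ℕ → ℕ} (hc : 1 ≤ cc) (hMw : ∀ L : ℕ, 2 ≤ L → 1 ≤ M L ∧ (L : ℝ) ≤ cc * M L) (hML : ∀ L : ℕ, 2 ≤ L → M L ≤ L)
    (hrep : D1Rep Lc Jc Nc μ ν a SL k) :
    D1Drift Lc (JsRowD1Pin hLc N) Nc μ ν :=
  d1Drift_JsRowD1Pin_of_borderBondLaw_D1Tel_D1Rep hLc hL2 hN (bondLaw hLc) a ha h12 h126 hSL k hμν hNc Jc htel hc hMw hML hrep

end Summit.QuantumFields.BalabanUV.Beta.RowD1SymmetriesDischarged
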